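import Mathlib.GroupTheory.Perm.Cycle.Type
import HarnessLib

/-!
# Switch visibility core: one re-pairing changes the parity of the loop count, and touches no other loop

Crux `Summit.CriticalPhenomena.CardyFormulaZ2.Theses.CardyMagicRigidity.NestingRigidity`
(stmt-CriticalPhenomena-4835), line `pinch-resampling` v3, brick B6 of the transfer stub S10 `stub_neckTomography`
(audit `S4-audit.md` §2 (i.1): "switching the pairing at one neck changes the number of loops through it by exactly
one"), in an abstract finite setting.

MODEL.  Orient every interface edge (open colour on its left, say), so that every edge is traversed exactly once; at a
4-valent vertex of the medial graph two edges come IN and two go OUT, alternating around the vertex, and a colour-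
consistent pairing matches each incoming edge with an outgoing one — the two such pairings are exactly the two
NON-crossing ones (the crossing pairing would match in with in).  A pairing system is therefore a SUCCESSOR PERMUTATION
`σ` of the finite set `E` of oriented edges (`σ e` = the outgoing edge paired with `e` at its head), and the loops are
the orbits of `σ` — ALL cycles including fixed points (an edge paired with itself), i.e. the parts of Mathlib's
`Equiv.Perm.partition σ` (cycle type plus one `1` per fixed point).  Switching the pairing at a vertex whose incoming
edges are `e₁ ≠ e₂` replaces `σ` by `σ * swap e₁ e₂` (`e₁ ↦ σ e₂`, `e₂ ↦ σ e₁`).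

RESULTS (pure group theory over `Equiv.Perm`, `Fintype`):
* `negOnePow_card_partition_add` — `(-1)^(#orbits σ + |E|) = sign σ` (from `sign_of_cycleType`, `sum_cycleType`);
* `odd_card_partition_mul_swap_add` (registered anchor) / `odd_card_partition_swap_mul_add` — for `x ≠ y` the orbit
  counts of `σ * swap x y` (resp. `swap x y * σ`) and of `σ` have DIFFERENT PARITY (`sign (swap x y) = -1`); hence
  `card_partition_mul_swap_ne`: a single switch always changes the number of loops;
* `pow_mul_swap_apply_of_not_sameCycle`, `sameCycle_mul_swap_iff_of_not_sameCycle` — an orbit of `σ` containing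
  neither `x` nor `y` is, pointwise and as a set, an orbit of `σ * swap x y`: the switch touches only the (one or two)
  loops through the vertex.  Together: two loops merge into one or one loop splits into two — the change is exactly `±1`.
-/

namespace Summit.CriticalPhenomena.CardyFormulaZ2.Cruxes.NestingRigidity.PinchResampling

open Equiv Equiv.Perm

variable {α : Type*} [Fintype α] [DecidableEq α]

/-- **Parity of the orbit count**: `(-1)^(#orbits σ + card α) = sign σ`, where `#orbits` counts ALL cycles including
fixed points (`Multiset.card σ.partition.parts = card (cycleType σ) + #fixed points`) — the classical
`sign σ = (-1)^(card α − #orbits)`, written additively. -/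
theorem negOnePow_card_partition_add (σ : Perm α) :
    (-1 : ℤˣ) ^ (Multiset.card σ.partition.parts + Fintype.card α) = Perm.sign σ := by
  rw [parts_partition, Multiset.card_add, Multiset.card_replicate, sign_of_cycleType, sum_cycleType]
  obtain ⟨d, hd⟩ := Nat.exists_eq_add_of_le σ.support.card_le_univ
  rw [hd, Nat.add_sub_cancel_left]
  have h : Multiset.card σ.cycleType + d + (σ.support.card + d) =
      σ.support.card + Multiset.card σ.cycleType + 2 * d := by ring
  rw [h, pow_add _ _ (2 * d), pow_mul]
  simp

/-- From `(-1)^a = -(-1)^b` to `Odd (a + b)` in `ℤˣ`. -/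
theorem odd_add_of_negOnePow_eq_neg {a b : ℕ} (h : (-1 : ℤˣ) ^ a = -(-1 : ℤˣ) ^ b) : Odd (a + b) := by
  rcases Nat.even_or_odd (a + b) with hab | hab
  · exfalso
    have h1 : (-1 : ℤˣ) ^ (a + b) = 1 := hab.neg_one_pow
    rw [pow_add, h, neg_mul, ← pow_add, ← two_mul, pow_mul] at h1
    simp at h1
  · exact hab

/-- **A single switch changes the parity of the number of loops (registered anchor; brick B6 of stub S10).**  For a
permutation `σ` of a finite type and `x ≠ y`, the orbit counts (all cycles, fixed points included) of `σ * swap x y`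
and of `σ` have different parity: their sum is odd (`sign (σ * swap x y) = -sign σ` and `negOnePow_card_partition_add`).
In the oriented pairing model of the module docstring: re-pairing the two incoming edges `x, y` of a 4-valent vertex
changes the number of loops by an odd amount — with `sameCycle_mul_swap_iff_of_not_sameCycle` (no other loop is
touched), by exactly `±1`: two loops merge or one loop splits. -/
theorem odd_card_partition_mul_swap_add : ∀ {α : Type*} [Fintype α] [DecidableEq α] (σ : Equiv.Perm α) {x y : α}, x ≠ y → Odd (Multiset.card (σ * Equiv.swap x y).partition.parts + Multiset.card σ.partition.parts) := by
  intro α _ _ σ x y hxy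
  have h' := negOnePow_card_partition_add (σ * swap x y)
  rw [Perm.sign_mul, Perm.sign_swap hxy, ← negOnePow_card_partition_add σ, mul_neg, mul_one] at h'
  have hodd := odd_add_of_negOnePow_eq_neg h'
  rcases hodd with ⟨k, hk⟩
  refine ⟨k - Fintype.card α, ?_⟩
  omega

/-- The same for the switch written on the left, `swap x y * σ` (re-pairing the two OUTGOING edges). -/
theorem odd_card_partition_swap_mul_add (σ : Perm α) {x y : α} (hxy : x ≠ y) :
    Odd (Multiset.card (swap x y * σ).partition.parts + Multiset.card σ.partition.parts) := by
  have h' := negOnePow_card_partition_add (swap x y * σ)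
  rw [Perm.sign_mul, Perm.sign_swap hxy, ← negOnePow_card_partition_add σ, neg_mul, one_mul] at h'
  have hodd := odd_add_of_negOnePow_eq_neg h'
  rcases hodd with ⟨k, hk⟩
  refine ⟨k - Fintype.card α, ?_⟩
  omega

/-- **Every single switch changes the number of loops.** -/
theorem card_partition_mul_swap_ne (σ : Perm α) {x y : α} (hxy : x ≠ y) :
    Multiset.card (σ * swap x y).partition.parts ≠ Multiset.card σ.partition.parts := by
  intro h
  have hodd := odd_card_partition_mul_swap_add σ hxy
  rw [h, ← two_mul] at hodd
  exact (Nat.not_even_iff_odd.2 hodd) (even_two_mul _)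

omit [Fintype α] in
/-- **The switch touches no other loop, pointwise**: on a point `a` whose `σ`-orbit contains neither `x` nor `y`, all
powers of `σ * swap x y` agree with those of `σ`. -/
theorem pow_mul_swap_apply_of_not_sameCycle (σ : Perm α) {x y a : α} (hx : ¬ σ.SameCycle a x)
    (hy : ¬ σ.SameCycle a y) : ∀ n : ℕ, ((σ * swap x y) ^ n) a = (σ ^ n) a
  | 0 => rfl
  | n + 1 => by
    have hxn : (σ ^ n) a ≠ x := fun h ↦ hx ⟨n, by simpa using h⟩
    have hyn : (σ ^ n) a ≠ y := fun h ↦ hy ⟨n, by simpa using h⟩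
    rw [pow_succ', Perm.mul_apply, pow_mul_swap_apply_of_not_sameCycle σ hx hy n, Perm.mul_apply,
      swap_apply_of_ne_of_ne hxn hyn, pow_succ', Perm.mul_apply]

/-- **The switch touches no other loop, as a set**: the orbit of such a point `a` is the same for `σ * swap x y` and
for `σ`.  Hence the orbit counts differ only through the (one or two) orbits through `x, y`: by
`odd_card_partition_mul_swap_add` the change is exactly `±1` (merge or split). -/
theorem sameCycle_mul_swap_iff_of_not_sameCycle (σ : Perm α) {x y a : α} (hx : ¬ σ.SameCycle a x)
    (hy : ¬ σ.SameCycle a y) (b : α) : (σ * swap x y).SameCycle a b ↔ σ.SameCycle a b := by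
  constructor
  · intro h
    obtain ⟨i, -, hi⟩ := h.exists_pow_eq'
    exact ⟨i, by rw [zpow_natCast, ← pow_mul_swap_apply_of_not_sameCycle σ hx hy i]; exact hi⟩
  · intro h
    obtain ⟨i, -, hi⟩ := h.exists_pow_eq'
    exact ⟨i, by rw [zpow_natCast, pow_mul_swap_apply_of_not_sameCycle σ hx hy i]; exact hi⟩

end Summit.CriticalPhenomena.CardyFormulaZ2.Cruxes.NestingRigidity.PinchResampling
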